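import Literature.AlgebraicGeometry.Motives.CartierDivisorGysin
import Literature.AlgebraicGeometry.Motives.ProjectiveSpaceFormDivisors
import HarnessLib

/-!
# The Gysin map of a hypersurface section of a projective variety

For a closed subvariety `ρ : X ↪ ℙᵈ_K` and a form `C` of degree `e ≥ 1` not vanishing identically
on `X`, the effective Cartier divisor `D = V₊(C)|_X` (`(ProjSpace.formDivisor C).pullbackAvoiding ρ`,
`Motives/ProjectiveSpaceFormDivisors`, `Motives/CartierDivisorClassPullback`) satisfies the two
hypotheses under which `Motives/CartierDivisorGysin` constructs Fulton's homomorphism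
`α ↦ D · α : CH_{k+1}(X) → CH_k(|D|)` (Fulton, *Intersection Theory*, Cor. 2.4.1 / Def. 2.4.1), namely

* `ProjSpace.exists_isEffective_sameDivisor_sub` — **on a closed subvariety `W ↪ ℙᵈ`, every
  `r ∈ R(W)ˣ` has `div(r) = D₁ - D₂` with `D₁, D₂` effective**: `r` lifts to a unit of
  `𝒪_{ℙᵈ, η_W}`, which is `F/G` for forms `F, G ∉ 𝔭_{η_W}` of the same degree
  (`ProjSpace.exists_forms_eq_div_of_isUnitAt`), and `D₁ = V₊(F)|_W`, `D₂ = V₊(G)|_W`;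
* `ProjSpace.exists_isEffective_linEquiv_classPullback_formDivisor` — **the class of `V₊(C)` pulled
  back to any `W → ℙᵈ` has an effective representative** `V₊(x_lᵉ)|_W` for a coordinate `x_l` not
  vanishing at the image of `η_W` (`V₊(C) ∼ e • H ∼ V₊(x_lᵉ)`);
* `ProjSpace.avoids_pullbackAvoiding_formDivisor_iff` — **`|V₊(C)|_X| = X ∩ V₊(C)`**;
* `ProjSpace.gysin_hypotheses` — the two hypotheses of `CartierDivisor.gysinCycle_mem_ratTrivial` /
  `CartierDivisor.IsEffective.gysin` for `D = V₊(C)|_X`.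

Everything is proved; no named facts.

## References

* W. Fulton, *Intersection Theory*, 2nd ed., Springer 1998, Cor. 2.4.1, Def. 2.4.1 (p. 38).
  [Fulton1998]
* R. Hartshorne, *Algebraic Geometry*, GTM 52 (1977), II Prop. 2.5 (a), II.6–7 (divisors on
  subvarieties of `ℙⁿ`). [Hartshorne1977]
-/

noncomputable section

universe u

open CategoryTheory AlgebraicGeometry Order Topology TopologicalSpace
open MvPolynomial (X C)
open Literature.AlgebraicGeometry.Motives.Segre Literature.AlgebraicGeometry.Motives.RatFn

attribute [local instance] MvPolynomial.gradedAlgebra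

namespace Literature.AlgebraicGeometry.Motives

namespace ProjSpace

variable {d : ℕ} {K : Type u} [Field K]

/-! ### `div(r) = V₊(F)|_W - V₊(G)|_W` on a closed subvariety `W ↪ ℙᵈ` -/

/-- **On a closed subvariety `j : W ↪ ℙᵈ`, every nonzero rational function `r` has
`div(r) = D₁ - D₂` with `D₁, D₂` effective Cartier divisors** (as the same divisor): `r` is the
restriction of a unit `F/G` of `𝒪_{ℙᵈ, j(η_W)}`, `F, G` forms of the same degree `e ≥ 1` not vanishing
at `j(η_W)` (`exists_forms_eq_div_of_isUnitAt`), and `D₁ = V₊(F)|_W`, `D₂ = V₊(G)|_W`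
(`formDivisor`, `CartierDivisor.pullbackAvoiding`). [folklore] -/
theorem exists_isEffective_sameDivisor_sub {W : Scheme.{u}} [IsIntegral W] (j : W ⟶ P d K)
    [IsClosedImmersion j] {r : W.functionField} (hr : r ≠ 0) :
    ∃ D₁ D₂ : CartierDivisor W, D₁.IsEffective ∧ D₂.IsEffective ∧
      (CartierDivisor.principal r hr).SameDivisor (D₁.sub D₂) := by
  -- lift `r` to a unit `s` of the local ring of `ℙᵈ` at `p = j(η_W)`
  obtain ⟨s, hs⟩ := j.stalkMap_surjective (genericPoint W) r
  have hsu : IsUnit s := by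
    have hru : IsUnit ((j.stalkMap (genericPoint W)).hom s) := by
      rw [show (j.stalkMap (genericPoint W)).hom s = r from hs]
      exact isUnit_iff_ne_zero.mpr hr
    exact (isUnit_map_iff (j.stalkMap (genericPoint W)).hom s).mp hru
  have hunit : IsUnitAt (j (genericPoint W)) (toFunctionField (j (genericPoint W)) s) :=
    ⟨hsu.unit, rfl⟩
  obtain ⟨e, F, G, he, hF, hG, hFp, hGp, hu⟩ := exists_forms_eq_div_of_isUnitAt hunit
  have hF0 : F ≠ 0 := fun h => hFp (h ▸ zero_mem _)
  have hG0 : G ≠ 0 := fun h => hGp (h ▸ zero_mem _)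
  have hFav : (formDivisor F hF hF0).Avoids (j (genericPoint W)) := (formDivisor_avoids_iff hF hF0 he).mpr hFp
  have hGav : (formDivisor G hG hG0).Avoids (j (genericPoint W)) := (formDivisor_avoids_iff hG hG0 he).mpr hGp
  -- `r = j^♯ (F/G)`
  have hr' : r = pullbackFn j (formToFunctionField 0 F / formToFunctionField 0 G) := by
    rw [← hu, pullbackFn_toFunctionField j (genericPoint W) s, toFunctionField_genericPoint]
    exact hs.symm
  refine ⟨(formDivisor F hF hF0).pullbackAvoiding j hFav, (formDivisor G hG hG0).pullbackAvoiding j hGav,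
    (isEffective_formDivisor hF hF0).pullbackAvoiding j hFav,
    (isEffective_formDivisor hG hG0).pullbackAvoiding j hGav, ?_⟩
  -- the local equations: `r / ((F/x_l^e) / (G/x_m^e)) = (G/x_m^e)/(G/x_l^e)`, a unit on `D₊(x_l) ∩ D₊(x_m)`
  rintro i ⟨q₁, q₂⟩ y - ⟨hy₁, hy₂⟩
  change IsUnitAt y (r / (pullbackFn j ((formDivisor F hF hF0).f q₁.1) /
    pullbackFn j ((formDivisor G hG hG0).f q₂.1)))
  set l := q₁.1.1.down.1 with hl
  set m := q₂.1.1.down.1 with hm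
  have hpl : j (genericPoint W) ∈ U l := (mem_formDivisor_U_iff hF hF0 q₁.1).1 q₁.2
  have hpm : j (genericPoint W) ∈ U m := (mem_formDivisor_U_iff hG hG0 q₂.1).1 q₂.2
  have hyl : j y ∈ U l := (mem_formDivisor_U_iff hF hF0 q₁.1).1 hy₁
  have hym : j y ∈ U m := (mem_formDivisor_U_iff hG hG0 q₂.1).1 hy₂
  rw [formDivisor_f, formDivisor_f, hr', ← formToFunctionField_div_eq l hF hG]
  have hFl : IsRegularAt (j (genericPoint W)) (formToFunctionField l F) := isRegularAt_formToFunctionField l hF hpl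
  have hGl : IsUnitAt (j (genericPoint W)) (formToFunctionField l G) :=
    (isUnitAt_formToFunctionField_iff l he hG hpl).2 hGp
  have hFlu : IsUnitAt (j (genericPoint W)) (formToFunctionField l F) :=
    (isUnitAt_formToFunctionField_iff l he hF hpl).2 hFp
  have hGm : IsUnitAt (j (genericPoint W)) (formToFunctionField m G) :=
    (isUnitAt_formToFunctionField_iff m he hG hpm).2 hGp
  rw [pullbackFn_div j hFl hGl]
  have h1 : pullbackFn j (formToFunctionField l F) ≠ 0 := pullbackFn_ne_zero j hFlu
  have h2 : pullbackFn j (formToFunctionField l G) ≠ 0 := pullbackFn_ne_zero j hGl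
  have h3 : pullbackFn j (formToFunctionField m G) ≠ 0 := pullbackFn_ne_zero j hGm
  have e1 : pullbackFn j (formToFunctionField l F) / pullbackFn j (formToFunctionField l G) /
      (pullbackFn j (formToFunctionField l F) / pullbackFn j (formToFunctionField m G)) =
      pullbackFn j (formToFunctionField m G) / pullbackFn j (formToFunctionField l G) := by
    field_simp
  rw [e1, ← pullbackFn_div j hGm.isRegularAt hGl]
  -- `(G/x_m^e) / (G/x_l^e) = (x_l/x_m)^e` is a unit on `D₊(x_l) ∩ D₊(x_m)`
  have h0G : formToFunctionField 0 G ≠ 0 := formToFunctionField_ne_zero 0 hG hG0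
  have key : formToFunctionField m G / formToFunctionField l G =
      ((hyperplane d K).f q₂.1.1 / (hyperplane d K).f q₁.1.1) ^ e := by
    rw [← hyperplane_f_pow_mul_formToFunctionField q₂.1.1 hG,
      ← hyperplane_f_pow_mul_formToFunctionField q₁.1.1 hG, div_pow,
      mul_div_mul_right _ _ h0G]
  have hyl' : j y ∈ (hyperplane d K).U q₁.1.1 := by rw [hyperplane_U]; exact hyl
  have hym' : j y ∈ (hyperplane d K).U q₂.1.1 := by rw [hyperplane_U]; exact hym
  have ht : IsUnitAt (j y) (formToFunctionField m G / formToFunctionField l G) := by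
    rw [key]
    exact ((hyperplane d K).isUnitAt_div q₂.1.1 q₁.1.1 (j y) hym' hyl').pow e
  exact ht.pullbackFn

/-! ### An effective representative of `V₊(C)|_W` -/

/-- **The class of `V₊(C)` pulled back to any `j : W → ℙᵈ` (`W` integral) has an effective
representative**, namely `V₊(x_lᵉ)|_W` for a coordinate `x_l` with `x_l ∉ 𝔭_{j(η_W)}` (`V₊(C) ∼ e • H
∼ V₊(x_lᵉ)` on `ℙᵈ`, and the latter avoids `j(η_W)`). [folklore] -/
theorem exists_isEffective_linEquiv_classPullback_formDivisor {W : Scheme.{u}} [IsIntegral W]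
    (j : W ⟶ P d K) {e : ℕ} (he : 0 < e) {C : MvPolynomial (Fin (d + 1)) K}
    (hC : C ∈ grading (Fin (d + 1)) K e) (hC0 : C ≠ 0) :
    ∃ P : CartierDivisor W, P.IsEffective ∧ P.LinEquiv ((formDivisor C hC hC0).classPullback j) := by
  obtain ⟨l, hl⟩ := exists_X_notMem (j (genericPoint W))
  have hG : (X l : MvPolynomial (Fin (d + 1)) K) ^ e ∈ grading (Fin (d + 1)) K e := by
    simpa using SetLike.pow_mem_graded e (X_mem K l)
  have hG0 : (X l : MvPolynomial (Fin (d + 1)) K) ^ e ≠ 0 := pow_ne_zero e (MvPolynomial.X_ne_zero l)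
  have hGp : (X l : MvPolynomial (Fin (d + 1)) K) ^ e ∉ (j (genericPoint W)).asHomogeneousIdeal :=
    fun h => hl ((j (genericPoint W)).isPrime.mem_of_pow_mem e h)
  have hGav : (formDivisor _ hG hG0).Avoids (j (genericPoint W)) := (formDivisor_avoids_iff hG hG0 he).mpr hGp
  refine ⟨(formDivisor _ hG hG0).pullbackAvoiding j hGav, (isEffective_formDivisor hG hG0).pullbackAvoiding j hGav, ?_⟩
  have hCG : (formDivisor C hC hC0).LinEquiv (formDivisor _ hG hG0) :=
    (smul_hyperplane_linEquiv_formDivisor hC hC0).symm.trans (smul_hyperplane_linEquiv_formDivisor hG hG0)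
  exact ((hCG.classPullback j).trans
    ((formDivisor _ hG hG0).classPullback_linEquiv_pullbackAvoiding j hGav)).symm

/-! ### The support of `V₊(C)|_Y` -/

/-- **`|V₊(C)|_Y| = Y ∩ V₊(C)`**: for a morphism `g : Y → ℙᵈ` (`Y` integral) with `g(η_Y) ∉ V₊(C)`,
the pulled-back divisor `V₊(C)|_Y` avoids `y` iff `C ∉ 𝔭_{g(y)}`. [folklore] -/
theorem avoids_pullbackAvoiding_formDivisor_iff {Y : Scheme.{u}} [IsIntegral Y] (g : Y ⟶ P d K)
    {e : ℕ} (he : 0 < e) {C : MvPolynomial (Fin (d + 1)) K} (hC : C ∈ grading (Fin (d + 1)) K e)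
    (hC0 : C ≠ 0) (h₀ : (formDivisor C hC hC0).Avoids (g (genericPoint Y))) (y : Y) :
    ((formDivisor C hC hC0).pullbackAvoiding g h₀).Avoids y ↔ C ∉ (g y).asHomogeneousIdeal := by
  rw [← formDivisor_avoids_iff hC hC0 he]
  constructor
  · intro h
    obtain ⟨i, hi⟩ := ((formDivisor C hC hC0).pullbackAvoiding g h₀).covers y
    have hu := h i hi
    rw [CartierDivisor.pullbackAvoiding_f] at hu
    exact CartierDivisor.Avoids.of_mem hi ((isEffective_formDivisor hC hC0 i.1 (g y) hi).isUnitAt_of_pullbackFn hu)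
  · intro h i hi
    rw [CartierDivisor.pullbackAvoiding_f]
    exact (h i.1 hi).pullbackFn

/-! ### The hypotheses of the Gysin map for `D = V₊(C)|_X` -/

/-- **The two hypotheses of `CartierDivisor.gysinCycle_mem_ratTrivial` hold for `D = V₊(C)|_X`**,
`ρ : X ↪ ℙᵈ` a closed subvariety and `C` a form of degree `e ≥ 1` with `X ⊄ V₊(C)`: every closed
subvariety `V ⊆ X` carries an effective representative of `D|_V`, and every `r ∈ R(V)ˣ` has
`div(r) = D₁ - D₂` with `D₁, D₂` effective. [folklore] -/
theorem gysin_hypotheses {X : Scheme.{u}} [IsIntegral X] (ρ : X ⟶ P d K) [IsClosedImmersion ρ]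
    {e : ℕ} (he : 0 < e) {C : MvPolynomial (Fin (d + 1)) K} (hC : C ∈ grading (Fin (d + 1)) K e)
    (hC0 : C ≠ 0) (h₀ : (formDivisor C hC hC0).Avoids (ρ (genericPoint X))) :
    (∀ V : ClosedSubvariety X,
      ¬ ((formDivisor C hC hC0).pullbackAvoiding ρ h₀).Avoids V.genericPoint →
        ∃ P : CartierDivisor V.carrier, P.IsEffective ∧
          P.LinEquiv (((formDivisor C hC hC0).pullbackAvoiding ρ h₀).classPullback V.ι)) ∧
    (∀ (V : ClosedSubvariety X) (r : V.carrier.functionField) (hr : r ≠ 0),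
      ∃ D₁ D₂ : CartierDivisor V.carrier, D₁.IsEffective ∧ D₂.IsEffective ∧
        (CartierDivisor.principal r hr).SameDivisor (D₁.sub D₂)) := by
  refine ⟨fun V _ => ?_, fun V r hr => exists_isEffective_sameDivisor_sub (V.ι ≫ ρ) hr⟩
  obtain ⟨P, hP, hlin⟩ := exists_isEffective_linEquiv_classPullback_formDivisor (V.ι ≫ ρ) he hC hC0
  refine ⟨P, hP, hlin.trans ?_⟩
  exact ((formDivisor C hC hC0).classPullback_comp_linEquiv ρ V.ι).trans
    (((formDivisor C hC hC0).classPullback_linEquiv_pullbackAvoiding ρ h₀).classPullback V.ι)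

end ProjSpace

end Literature.AlgebraicGeometry.Motives

end
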